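import Literature.Barriers.Parity.SiegelZeroQuadraticPolynomialsTheorem4Holds
import Literature.Barriers.Parity.SiegelZeroQuadraticPolynomialsProp2Holds
import HarnessLib

/-!
# The catalogued barrier `SiegelZeroQuadraticPolynomials` (Granville–Mollin 2000, Theorem 4 ∧
# Proposition 2), discharged

Topic `Literature/Barriers/Parity`, companion of the catalogue entry
`SiegelZeroQuadraticPolynomials.lean` (Granville–Mollin, *Rabinowitsch revisited*, Acta Arith. 96
(2000)). Everything here is PROVED; no definition is introduced.

* `SiegelZeroQuadraticPolynomials_holds` — the catalogued declaration
  `Literature.Barriers.Parity.SiegelZeroQuadraticPolynomials = GranvilleMollin2000_thm4 ∧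
  GranvilleMollin2000_prop2`, DISCHARGED from its two halves, both theorems of the tree:
  `GranvilleMollin2000_thm4_holds` (`SiegelZeroQuadraticPolynomialsTheorem4Holds.lean`: the sieve
  argument of §6A–6B fed by the two exceptional-prime estimates of §5C, themselves proved by the
  elementary route — upper-bound sieve on `χ ∗ 1` and Tao–Teräväinen's Proposition 3.5) and
  `GranvilleMollin2000_prop2_holds` (`SiegelZeroQuadraticPolynomialsProp2Holds.lean`: the
  Tao–Teräväinen positivity method in place of the Linnik-range explicit formula (3.3)).
* `UniformQuadraticBatemanHorn.zeroFree` — the unconditional form of the barrier's consequence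
  `SiegelZeroQuadraticPolynomials.zeroFree_of_uniformBH`: Bateman–Horn for `x² + x + (1 − d)/4`
  uniform in `N ≥ |d|^C` forces `L(1 − 1/(η log|d|), χ_d) ≠ 0` for every `η ≥ log|d|` and all large
  fundamental `d ≡ 5 (mod 8)`.

The trust base of the barrier is now empty (Mathlib's axioms only); the explicit-formula inputs
`GranvilleMollin2000_eq33` / `truncatedExplicitFormula_psiChar` / `GranvilleMollin2000_eq32` of the
earlier conditional assembly (`SiegelZeroQuadraticPolynomials_of_inputs`) are not used.

[cite: GranvilleMollin2000, Theorem 4, Proposition 2, §5C, §6A–6B and §8]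
[cite: TaoTeravainen2021, §3.3 and Proposition 3.5]
-/

noncomputable section

namespace Literature.Barriers.Parity

/-- **The catalogued barrier `SiegelZeroQuadraticPolynomials`, discharged**: Granville–Mollin's
Theorem 4 and Proposition 2, both proved in the tree. [cite: GranvilleMollin2000, Theorem 4 and Proposition 2] -/
theorem SiegelZeroQuadraticPolynomials_holds : SiegelZeroQuadraticPolynomials :=
  ⟨GranvilleMollin2000_thm4_holds, GranvilleMollin2000_prop2_holds⟩

/-- **Uniform Bateman–Horn for `x² + x + A` at polynomial scale forces a zero-free region of
Siegel type — unconditionally a valid implication**: if `UniformQuadraticBatemanHorn C₀` holds for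
some `C₀`, then for all negative fundamental `d ≡ 5 (mod 8)` with `|d|` large, the primitive
quadratic character `χ_d` mod `|d|` and every `η ≥ log|d|`: `L(1 − 1/(η log|d|), χ_d) ≠ 0`
(the barrier's `zeroFree_of_uniformBH` fed with `SiegelZeroQuadraticPolynomials_holds`).
[cite: GranvilleMollin2000, Theorem 4 and Proposition 2] -/
theorem UniformQuadraticBatemanHorn.zeroFree {C₀ : ℝ} (hU : UniformQuadraticBatemanHorn C₀) :
    ∃ d₀ : ℝ, ∀ d : ℤ, IsNegFundOne d → d % 8 = 5 → d₀ ≤ |(d : ℝ)| →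
      ∀ (q : ℕ) [NeZero q], (q : ℤ) = |d| → ∀ χ : DirichletCharacter ℂ q, χ.IsPrimitive →
        χ.IsQuadratic → ∀ η : ℝ, Real.log |(d : ℝ)| ≤ η →
          χ.LFunction ((1 - 1 / (η * Real.log |(d : ℝ)|) : ℝ) : ℂ) ≠ 0 :=
  SiegelZeroQuadraticPolynomials_holds.zeroFree_of_uniformBH hU

end Literature.Barriers.Parity
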